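import Mathlib
import HarnessLib
import Literature.Analysis.FluidPDE.SelfSimilarEulerProfile

/-!
# Crux E `PowerGaugeEulerLiouville` (stmt-NavierStokesRegularity-19832) — brick «THE HIGH-BERNOULLI SET IS
# THIN» (RESIDUE-MEMO-g11 (F3)+(A), input of line C2; LEAD ns-typeII-p2 g11 text 10:45:58Z (2))

Width-seat file (prover ns-sz-p1 g4; DIRECTOR-NS #206 (3) returned this brick to the 19832 pool).  For
the self-similar Bernoulli function `ℋ(y) = ½|γy + V(y)|² + P(y) + ½γ(γ−1)|y|²`
(`selfSimilarBernoulli γ 0 V P`, Constantin–Ignatova–Vicol (3.30)) at the class rate `γ = 1/(2+ρ)`,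
`0 < ρ < 1` (so `γ < ½`), a profile with the class growth `∫_{B_L} |V|² ≤ c L^{1−2ρ}` and a pressure with
`∫ |P|^{3/2} |y|^{2ρ−2} ≤ C` has THIN super-level sets of `ℋ` on dyadic shells:
`|{ℋ > h} ∩ {L ≤ |y| ≤ 2L}| ≤ C' L^{−1−2ρ}` for `L ≥ L₀(h, ρ)`.

Proof (the LEAD's split, with `a := γ(½ − γ)/2 > 0`, `m := √(γ/2) − γ > 0`): on `{ℋ > h}` either
`P(y) > a|y|² ≥ aL²` — Chebyshev against the weighted `L^{3/2}` bound with shell weight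
`|y|^{2ρ−2} ≥ (2L)^{2ρ−2}`: volume `≤ C (aL²)^{−3/2} (2L)^{2−2ρ}` — or
`|γy + V(y)|² > 2h + (γ/2)|y|²`, whence for `L ≥ L₀` (`√(2|h|) ≤ (m/2)L`) `|V(y)| ≥ (m/2)L` —
Chebyshev against `∫_{B_{3L}} |V|² ≤ c(3L)^{1−2ρ}`: volume `≤ c (3L)^{1−2ρ} ((m/2)L)^{−2}`.  Both are
`≍ L^{−1−2ρ}`.

* `volume_bernoulliHigh_inter_shell_le` — the brick, ρ as the parameter, `γ := 1/(2+ρ)`.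

HONEST FRAMING: a by-name helper (`--supports … --as helper`); crux E 19832, its line and the summit
are OPEN; nothing here is credited toward them.
-/

noncomputable section

set_option linter.dupNamespace false

namespace Summit.NavierStokesRegularity.NavierStokesRegularity.Theorems.PowerGaugeEulerLiouville.BernoulliThinness

open MeasureTheory Set Filter Topology Metric Function InnerProductSpace
open scoped RealInnerProductSpace NNReal ENNReal
open Literature.Analysis Literature.Analysis.FluidPDE

/-! ### Elementary inequalities -/

/-- `X² > A² − B²` with `0 ≤ B ≤ A`, `0 ≤ X` gives `X > A − B`. -/
theorem sub_lt_of_sq_lt {X A B : ℝ} (hX : 0 ≤ X) (hB : 0 ≤ B) (hBA : B ≤ A)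
    (h : A ^ 2 - B ^ 2 < X ^ 2) : A - B < X := by
  have h1 : (A - B) ^ 2 ≤ A ^ 2 - B ^ 2 := by nlinarith
  have h2 : (A - B) ^ 2 < X ^ 2 := lt_of_le_of_lt h1 h
  exact lt_of_pow_lt_pow_left₀ 2 hX h2

/-- Chebyshev in the form `μ S ≤ (∫⁻ f) / λ` for a set on which `λ ≤ f`. -/
theorem measure_le_lintegral_div {α : Type*} [MeasurableSpace α] {μ : Measure α} {f : α → ℝ≥0∞}
    (hf : AEMeasurable f μ) {lam : ℝ≥0∞} (h0 : lam ≠ 0) (htop : lam ≠ ∞) {S : Set α}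
    (hS : ∀ x ∈ S, lam ≤ f x) : μ S ≤ (∫⁻ x, f x ∂μ) / lam := by
  have h1 : lam * μ S ≤ ∫⁻ x, f x ∂μ :=
    (mul_le_mul' le_rfl (measure_mono (fun x hx => hS x hx))).trans (mul_meas_ge_le_lintegral₀ hf lam)
  rw [ENNReal.le_div_iff_mul_le (Or.inl h0) (Or.inl htop), mul_comm]
  exact h1

/-! ### The brick -/

set_option maxHeartbeats 400000 in
/-- **THE HIGH-BERNOULLI SET IS THIN** (LEAD ns-typeII-p2 g11, 10:45:58Z (2); ρ as the parameter,
`γ := 1/(2+ρ)`).  For `0 < ρ < 1`, a profile `V` with `∫_{B_L} |V|² ≤ c L^{1−2ρ}` for all `L > 0` and a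
pressure `P` with `∫ |P|^{3/2} |y|^{2ρ−2} ≤ C`, every level `h`: there are `C', L₀ > 0` with
`|{y : h < ℋ(y)} ∩ {L ≤ |y| ≤ 2L}| ≤ C' L^{−1−2ρ}` for all `L ≥ L₀`, `ℋ = selfSimilarBernoulli (1/(2+ρ)) 0 V P`. -/
theorem volume_bernoulliHigh_inter_shell_le {ρ : ℝ} (hρ : 0 < ρ) (hρ1 : ρ < 1)
    {V : EuclideanSpace ℝ (Fin 3) → EuclideanSpace ℝ (Fin 3)} (hVm : AEStronglyMeasurable V volume)
    {c : ℝ≥0}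
    (hA : ∀ L : ℝ, 0 < L → ∫⁻ y in ball (0 : EuclideanSpace ℝ (Fin 3)) L, ‖V y‖ₑ ^ 2 ≤
      c * ENNReal.ofReal (L ^ (1 - 2 * ρ)))
    {P : EuclideanSpace ℝ (Fin 3) → ℝ} (hPm : AEStronglyMeasurable P volume) {C : ℝ}
    (hD : ∫⁻ y, ‖P y‖ₑ ^ (3 / 2 : ℝ) * ENNReal.ofReal (‖y‖ ^ (2 * ρ - 2)) ≤ ENNReal.ofReal C)
    (h : ℝ) :
    ∃ C' L₀ : ℝ, 0 < L₀ ∧ ∀ L : ℝ, L₀ ≤ L →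
      volume ({y : EuclideanSpace ℝ (Fin 3) | h < selfSimilarBernoulli (1 / (2 + ρ)) 0 V P y} ∩
        {y | L ≤ ‖y‖ ∧ ‖y‖ ≤ 2 * L}) ≤ ENNReal.ofReal (C' * L ^ (-1 - 2 * ρ)) := by
  -- ### constants
  have h2ρ : (0 : ℝ) < 2 + ρ := by linarith
  set γ : ℝ := 1 / (2 + ρ) with hγdef
  have hγ : 0 < γ := by positivity
  have hγhalf : γ < 1 / 2 := by
    rw [hγdef]; exact one_div_lt_one_div_of_lt two_pos (by linarith)
  set a : ℝ := γ * (1 / 2 - γ) / 2 with hadef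
  have ha : 0 < a := by rw [hadef]; nlinarith
  set m : ℝ := Real.sqrt (γ / 2) - γ with hmdef
  have hsq : γ < Real.sqrt (γ / 2) := by
    rw [Real.lt_sqrt hγ.le]; nlinarith
  have hm : 0 < m := by rw [hmdef]; linarith
  have hmle : m ≤ Real.sqrt (γ / 2) := by rw [hmdef]; linarith
  set Cp : ℝ := max C 0 with hCp
  have hCp0 : 0 ≤ Cp := le_max_right _ _
  have hD' : ∫⁻ y, ‖P y‖ₑ ^ (3 / 2 : ℝ) * ENNReal.ofReal (‖y‖ ^ (2 * ρ - 2)) ≤ ENNReal.ofReal Cp :=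
    hD.trans (ENNReal.ofReal_le_ofReal (le_max_left _ _))
  -- the two constants and the threshold
  set k₁ : ℝ := a ^ (3 / 2 : ℝ) * (2 : ℝ) ^ (2 * ρ - 2) with hk₁
  have hk₁pos : 0 < k₁ := by positivity
  set k₂ : ℝ := (c : ℝ) * (3 : ℝ) ^ (1 - 2 * ρ) / (m / 2) ^ 2 with hk₂
  have hk₂nn : 0 ≤ k₂ := by positivity
  set L₀ : ℝ := 1 + 2 * Real.sqrt (2 * |h|) / m with hL₀
  have hL₀pos : 0 < L₀ := by positivity
  refine ⟨Cp / k₁ + k₂, L₀, hL₀pos, fun L hL => ?_⟩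
  have hL1 : 1 ≤ L := by
    have : 0 ≤ 2 * Real.sqrt (2 * |h|) / m := by positivity
    linarith
  have hLpos : 0 < L := by linarith
  have hhL : Real.sqrt (2 * |h|) ≤ m / 2 * L := by
    have h1 : 2 * Real.sqrt (2 * |h|) / m ≤ L := by linarith
    rw [div_le_iff₀ hm] at h1
    linarith
  -- ### the two Chebyshev functions
  set f : EuclideanSpace ℝ (Fin 3) → ℝ≥0∞ := fun y =>
    ‖P y‖ₑ ^ (3 / 2 : ℝ) * ENNReal.ofReal (‖y‖ ^ (2 * ρ - 2)) with hf
  have hfm : AEMeasurable f volume :=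
    (hPm.aemeasurable.enorm.pow_const _).mul
      ((measurable_norm.pow_const _).ennreal_ofReal.aemeasurable)
  set g : EuclideanSpace ℝ (Fin 3) → ℝ≥0∞ :=
    (ball (0 : EuclideanSpace ℝ (Fin 3)) (3 * L)).indicator fun y => ‖V y‖ₑ ^ 2 with hg
  have hgm : AEMeasurable g volume := (hVm.aemeasurable.enorm.pow_const _).indicator measurableSet_ball
  have hgint : ∫⁻ y, g y = ∫⁻ y in ball (0 : EuclideanSpace ℝ (Fin 3)) (3 * L), ‖V y‖ₑ ^ 2 := by
    rw [hg, lintegral_indicator measurableSet_ball]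
  -- thresholds
  set lamP : ℝ≥0∞ := ENNReal.ofReal (k₁ * L ^ (1 + 2 * ρ)) with hlamP
  set lamV : ℝ≥0∞ := ENNReal.ofReal ((m / 2 * L) ^ 2) with hlamV
  have hlamP0 : lamP ≠ 0 := (ENNReal.ofReal_pos.2 (by positivity)).ne'
  have hlamV0 : lamV ≠ 0 := (ENNReal.ofReal_pos.2 (by positivity)).ne'
  -- ### the split of the target set
  set T : Set (EuclideanSpace ℝ (Fin 3)) :=
    {y | h < selfSimilarBernoulli (1 / (2 + ρ)) 0 V P y} ∩ {y | L ≤ ‖y‖ ∧ ‖y‖ ≤ 2 * L} with hT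
  set SP : Set (EuclideanSpace ℝ (Fin 3)) := {y | L ≤ ‖y‖ ∧ ‖y‖ ≤ 2 * L ∧ a * ‖y‖ ^ 2 < P y} with hSP
  set SV : Set (EuclideanSpace ℝ (Fin 3)) := {y | ‖y‖ ≤ 2 * L ∧ m / 2 * L ≤ ‖V y‖} with hSV
  have hsplit : T ⊆ SP ∪ SV := by
    rintro y ⟨hy, hyL, hy2L⟩
    rw [mem_setOf_eq, selfSimilarBernoulli_apply, sub_zero] at hy
    by_cases hP : a * ‖y‖ ^ 2 < P y
    · exact Or.inl ⟨hyL, hy2L, hP⟩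
    · right
      refine ⟨hy2L, ?_⟩
      push Not at hP
      have hyn : 0 < ‖y‖ := lt_of_lt_of_le hLpos hyL
      -- `‖γy + Vy‖² > 2h + (γ/2)‖y‖²`
      have hkin : 2 * h + γ / 2 * ‖y‖ ^ 2 < ‖γ • y + V y‖ ^ 2 := by
        have e : γ * (γ - 1) / 2 * ‖y‖ ^ 2 = -(γ * (1 - γ) / 2) * ‖y‖ ^ 2 := by ring
        rw [e] at hy
        have : γ * (1 - γ) / 2 - a = γ / 4 := by rw [hadef]; ring
        nlinarith
      -- `‖γy + Vy‖ > √(γ/2)‖y‖ − √(2|h|)`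
      have hB : Real.sqrt (2 * |h|) ≤ Real.sqrt (γ / 2) * ‖y‖ := by
        calc Real.sqrt (2 * |h|) ≤ m / 2 * L := hhL
          _ ≤ m * ‖y‖ := by nlinarith
          _ ≤ Real.sqrt (γ / 2) * ‖y‖ := mul_le_mul_of_nonneg_right hmle (norm_nonneg _)
      have hX : Real.sqrt (γ / 2) * ‖y‖ - Real.sqrt (2 * |h|) < ‖γ • y + V y‖ := by
        refine sub_lt_of_sq_lt (norm_nonneg _) (Real.sqrt_nonneg _) hB ?_
        have e1 : (Real.sqrt (γ / 2) * ‖y‖) ^ 2 = γ / 2 * ‖y‖ ^ 2 := by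
          rw [mul_pow, Real.sq_sqrt (by positivity)]
        have e2 : Real.sqrt (2 * |h|) ^ 2 = 2 * |h| := Real.sq_sqrt (by positivity)
        rw [e1, e2]
        have : -(2 * |h|) ≤ 2 * h := by
          have := neg_abs_le h; linarith
        linarith
      -- `‖Vy‖ ≥ ‖γy + Vy‖ − γ‖y‖ > m‖y‖ − √(2|h|) ≥ (m/2) L`
      have hV1 : ‖γ • y + V y‖ ≤ γ * ‖y‖ + ‖V y‖ := by
        calc ‖γ • y + V y‖ ≤ ‖γ • y‖ + ‖V y‖ := norm_add_le _ _
          _ = γ * ‖y‖ + ‖V y‖ := by rw [norm_smul, Real.norm_of_nonneg hγ.le]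
      have hmy : m * ‖y‖ - Real.sqrt (2 * |h|) ≥ m / 2 * L := by nlinarith
      rw [hmdef] at hmy
      linarith
  -- ### Chebyshev for the pressure part
  have hSP : volume SP ≤ ENNReal.ofReal Cp / lamP := by
    refine (measure_le_lintegral_div hfm hlamP0 ENNReal.ofReal_ne_top fun y hy => ?_).trans
      (ENNReal.div_le_div_right hD' _)
    obtain ⟨hyL, hy2L, hP⟩ := hy
    have hyn : 0 < ‖y‖ := lt_of_lt_of_le hLpos hyL
    -- `‖P y‖ ≥ a L²` and `‖y‖^{2ρ−2} ≥ (2L)^{2ρ−2}`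
    have hPy : a * L ^ 2 ≤ ‖P y‖ := by
      have : a * L ^ 2 ≤ a * ‖y‖ ^ 2 := by
        exact mul_le_mul_of_nonneg_left (pow_le_pow_left₀ hLpos.le hyL 2) ha.le
      exact this.trans (hP.le.trans (Real.le_norm_self _))
    have hw : (2 * L) ^ (2 * ρ - 2) ≤ ‖y‖ ^ (2 * ρ - 2) :=
      Real.rpow_le_rpow_of_nonpos hyn hy2L (by linarith)
    rw [hf]; dsimp only
    rw [hlamP]
    have e : k₁ * L ^ (1 + 2 * ρ) = (a * L ^ 2) ^ (3 / 2 : ℝ) * (2 * L) ^ (2 * ρ - 2) := by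
      rw [hk₁, Real.mul_rpow ha.le (by positivity), Real.mul_rpow (by norm_num) hLpos.le]
      have e3 : (L ^ 2) ^ (3 / 2 : ℝ) = L ^ (3 : ℝ) := by
        rw [← Real.rpow_natCast L 2, ← Real.rpow_mul hLpos.le]; norm_num
      rw [e3]
      have e4 : L ^ (1 + 2 * ρ) = L ^ (3 : ℝ) * L ^ (2 * ρ - 2) := by
        rw [← Real.rpow_add hLpos]; ring_nf
      rw [e4]; ring
    rw [e, ENNReal.ofReal_mul (by positivity)]
    refine mul_le_mul' ?_ (ENNReal.ofReal_le_ofReal hw)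
    calc ENNReal.ofReal ((a * L ^ 2) ^ (3 / 2 : ℝ))
        = ENNReal.ofReal (a * L ^ 2) ^ (3 / 2 : ℝ) := by
          rw [ENNReal.ofReal_rpow_of_nonneg (by positivity) (by norm_num)]
      _ ≤ ‖P y‖ₑ ^ (3 / 2 : ℝ) := by
          refine ENNReal.rpow_le_rpow ?_ (by norm_num)
          rw [← ofReal_norm]
          exact ENNReal.ofReal_le_ofReal hPy
  -- ### Chebyshev for the kinetic part
  have hSV : volume SV ≤ (c * ENNReal.ofReal ((3 * L) ^ (1 - 2 * ρ))) / lamV := by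
    refine (measure_le_lintegral_div hgm hlamV0 ENNReal.ofReal_ne_top fun y hy => ?_).trans ?_
    · obtain ⟨hy2L, hVy⟩ := hy
      have hyb : y ∈ ball (0 : EuclideanSpace ℝ (Fin 3)) (3 * L) := by
        rw [mem_ball, dist_zero_right]; linarith
      rw [hg, indicator_of_mem hyb, hlamV, ← ofReal_norm, ← ENNReal.ofReal_pow (norm_nonneg _)]
      exact ENNReal.ofReal_le_ofReal (pow_le_pow_left₀ (by positivity) hVy 2)
    · rw [hgint]
      exact ENNReal.div_le_div_right (hA (3 * L) (by positivity)) _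
  -- ### assembling
  have hneg : L ^ (-1 - 2 * ρ) = (L ^ (1 + 2 * ρ))⁻¹ := by
    rw [show (-1 - 2 * ρ : ℝ) = -(1 + 2 * ρ) by ring, Real.rpow_neg hLpos.le]
  have hLpow : 0 < L ^ (1 + 2 * ρ) := Real.rpow_pos_of_pos hLpos _
  have hP' : ENNReal.ofReal Cp / lamP = ENNReal.ofReal (Cp / k₁ * L ^ (-1 - 2 * ρ)) := by
    rw [hlamP, ← ENNReal.ofReal_div_of_pos (by positivity)]
    congr 1
    rw [hneg]
    field_simp
  have hV' : (c * ENNReal.ofReal ((3 * L) ^ (1 - 2 * ρ))) / lamV =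
      ENNReal.ofReal (k₂ * L ^ (-1 - 2 * ρ)) := by
    rw [hlamV, ← ENNReal.ofReal_coe_nnreal, ← ENNReal.ofReal_mul (NNReal.coe_nonneg c),
      ← ENNReal.ofReal_div_of_pos (by positivity)]
    congr 1
    rw [hk₂, Real.mul_rpow (by norm_num) hLpos.le]
    have e1 : L ^ (1 - 2 * ρ) = L ^ (-1 - 2 * ρ) * L ^ 2 := by
      rw [← Real.rpow_natCast L 2, ← Real.rpow_add hLpos]; congr 1; push_cast; ring
    rw [e1]
    field_simp
  calc volume T ≤ volume (SP ∪ SV) := measure_mono hsplit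
    _ ≤ volume SP + volume SV := measure_union_le _ _
    _ ≤ ENNReal.ofReal Cp / lamP + (c * ENNReal.ofReal ((3 * L) ^ (1 - 2 * ρ))) / lamV :=
        add_le_add hSP hSV
    _ = ENNReal.ofReal ((Cp / k₁ + k₂) * L ^ (-1 - 2 * ρ)) := by
        rw [hP', hV', ← ENNReal.ofReal_add (by positivity) (by positivity)]
        congr 1; ring

/-! ### Corollary: every superlevel set of `ℋ` has finite volume -/

/-- Geometric tail: for `s < 0` and `L₀ > 0`, `∑ₖ ofReal (B · (2^k L₀)^s) < ∞`. -/
theorem tsum_ofReal_mul_two_pow_mul_rpow_lt_top (B : ℝ) {L₀ s : ℝ} (hL₀ : 0 < L₀) (hs : s < 0) :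
    ∑' k : ℕ, ENNReal.ofReal (B * (2 ^ k * L₀) ^ s) < ∞ := by
  set q : ℝ≥0∞ := ENNReal.ofReal ((2 : ℝ) ^ s) with hq
  have hq1 : q < 1 :=
    ENNReal.ofReal_lt_one.2 (Real.rpow_lt_one_of_one_lt_of_neg (by norm_num) hs)
  have h2s : 0 ≤ (2 : ℝ) ^ s := by positivity
  have hterm : ∀ k : ℕ, ENNReal.ofReal (B * (2 ^ k * L₀) ^ s) ≤
      ENNReal.ofReal (|B| * L₀ ^ s) * q ^ k := by
    intro k
    rw [hq, ← ENNReal.ofReal_pow h2s, ← ENNReal.ofReal_mul (by positivity)]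
    apply ENNReal.ofReal_le_ofReal
    rw [Real.mul_rpow (by positivity) hL₀.le, ← Real.rpow_pow_comm (by norm_num : (0 : ℝ) ≤ 2)]
    have hnn : 0 ≤ ((2 : ℝ) ^ s) ^ k * L₀ ^ s := by positivity
    nlinarith [le_abs_self B]
  calc ∑' k : ℕ, ENNReal.ofReal (B * (2 ^ k * L₀) ^ s)
      ≤ ∑' k : ℕ, ENNReal.ofReal (|B| * L₀ ^ s) * q ^ k := ENNReal.tsum_le_tsum hterm
    _ = ENNReal.ofReal (|B| * L₀ ^ s) * (1 - q)⁻¹ := by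
        rw [ENNReal.tsum_mul_left, ENNReal.tsum_geometric]
    _ < ∞ := ENNReal.mul_lt_top ENNReal.ofReal_lt_top
        (ENNReal.inv_lt_top.2 (tsub_pos_iff_lt.2 hq1))

/-- **Corollary (`vol Θ_h < ∞`).**  Under the hypotheses of
`volume_bernoulliHigh_inter_shell_le`, every superlevel set `{y : h < ℋ(y)}` of the self-similar
Bernoulli function has finite Lebesgue measure: cover it by `closedBall 0 L₀` and the dyadic shells
`2^k L₀ ≤ |y| ≤ 2^{k+1} L₀`, and sum the geometric tail `C' (2^k L₀)^{−1−2ρ}`. -/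
theorem volume_bernoulliHigh_lt_top {ρ : ℝ} (hρ : 0 < ρ) (hρ1 : ρ < 1)
    {V : EuclideanSpace ℝ (Fin 3) → EuclideanSpace ℝ (Fin 3)} (hVm : AEStronglyMeasurable V volume)
    {c : ℝ≥0}
    (hA : ∀ L : ℝ, 0 < L → ∫⁻ y in ball (0 : EuclideanSpace ℝ (Fin 3)) L, ‖V y‖ₑ ^ 2 ≤
      c * ENNReal.ofReal (L ^ (1 - 2 * ρ)))
    {P : EuclideanSpace ℝ (Fin 3) → ℝ} (hPm : AEStronglyMeasurable P volume) {C : ℝ}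
    (hD : ∫⁻ y, ‖P y‖ₑ ^ (3 / 2 : ℝ) * ENNReal.ofReal (‖y‖ ^ (2 * ρ - 2)) ≤ ENNReal.ofReal C)
    (h : ℝ) :
    volume {y : EuclideanSpace ℝ (Fin 3) | h < selfSimilarBernoulli (1 / (2 + ρ)) 0 V P y} < ∞ := by
  obtain ⟨C', L₀, hL₀, hshell⟩ := volume_bernoulliHigh_inter_shell_le hρ hρ1 hVm hA hPm hD h
  set Θ : Set (EuclideanSpace ℝ (Fin 3)) :=
    {y | h < selfSimilarBernoulli (1 / (2 + ρ)) 0 V P y} with hΘ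
  set Sh : ℕ → Set (EuclideanSpace ℝ (Fin 3)) :=
    fun k => Θ ∩ {y | 2 ^ k * L₀ ≤ ‖y‖ ∧ ‖y‖ ≤ 2 * (2 ^ k * L₀)} with hSh
  have hcover : Θ ⊆ closedBall (0 : EuclideanSpace ℝ (Fin 3)) L₀ ∪ ⋃ k : ℕ, Sh k := by
    intro y hy
    by_cases hyL : ‖y‖ ≤ L₀
    · exact Or.inl (mem_closedBall_zero_iff.mpr hyL)
    · right
      have hyL' : L₀ < ‖y‖ := lt_of_not_ge hyL
      have h1 : 1 ≤ ‖y‖ / L₀ := by rw [le_div_iff₀ hL₀]; linarith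
      obtain ⟨k, hk1, hk2⟩ := exists_nat_pow_near h1 one_lt_two
      refine mem_iUnion.mpr ⟨k, hy, ?_, ?_⟩
      · have := (le_div_iff₀ hL₀).mp hk1
        linarith
      · have := (div_lt_iff₀ hL₀).mp hk2
        rw [pow_succ] at this
        linarith
  have hSk : ∀ k : ℕ, volume (Sh k) ≤ ENNReal.ofReal (C' * (2 ^ k * L₀) ^ (-1 - 2 * ρ)) := fun k =>
    hshell _ (le_mul_of_one_le_left hL₀.le (one_le_pow₀ one_le_two))
  calc volume Θ ≤ volume (closedBall (0 : EuclideanSpace ℝ (Fin 3)) L₀ ∪ ⋃ k : ℕ, Sh k) :=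
        measure_mono hcover
    _ ≤ volume (closedBall (0 : EuclideanSpace ℝ (Fin 3)) L₀) + volume (⋃ k : ℕ, Sh k) :=
        measure_union_le _ _
    _ ≤ volume (closedBall (0 : EuclideanSpace ℝ (Fin 3)) L₀) +
          ∑' k : ℕ, ENNReal.ofReal (C' * (2 ^ k * L₀) ^ (-1 - 2 * ρ)) :=
        add_le_add le_rfl ((measure_iUnion_le _).trans (ENNReal.tsum_le_tsum hSk))
    _ < ∞ := ENNReal.add_lt_top.mpr ⟨measure_closedBall_lt_top,
        tsum_ofReal_mul_two_pow_mul_rpow_lt_top C' hL₀ (by linarith)⟩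

/-! ### Corollary: polynomial tail `vol(Θ_h ∩ {R ≤ |y|}) ≤ C″ R^{−1−2ρ}` -/

/-- Closed form of the geometric tail: for `s < 0`, `R > 0`,
`∑ₖ ofReal (B · (2^k R)^s) ≤ ofReal (|B| (1 − 2^s)⁻¹ · R^s)`. -/
theorem tsum_ofReal_mul_two_pow_mul_rpow_le (B : ℝ) {R s : ℝ} (hR : 0 < R) (hs : s < 0) :
    ∑' k : ℕ, ENNReal.ofReal (B * (2 ^ k * R) ^ s) ≤
      ENNReal.ofReal (|B| * (1 - (2 : ℝ) ^ s)⁻¹ * R ^ s) := by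
  set q : ℝ≥0∞ := ENNReal.ofReal ((2 : ℝ) ^ s) with hq
  have h2s1 : (2 : ℝ) ^ s < 1 := Real.rpow_lt_one_of_one_lt_of_neg (by norm_num) hs
  have h2s : 0 ≤ (2 : ℝ) ^ s := by positivity
  have hterm : ∀ k : ℕ, ENNReal.ofReal (B * (2 ^ k * R) ^ s) ≤
      ENNReal.ofReal (|B| * R ^ s) * q ^ k := by
    intro k
    rw [hq, ← ENNReal.ofReal_pow h2s, ← ENNReal.ofReal_mul (by positivity)]
    apply ENNReal.ofReal_le_ofReal
    rw [Real.mul_rpow (by positivity) hR.le, ← Real.rpow_pow_comm (by norm_num : (0 : ℝ) ≤ 2)]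
    have hnn : 0 ≤ ((2 : ℝ) ^ s) ^ k * R ^ s := by positivity
    nlinarith [le_abs_self B]
  have hgeom : (1 - q)⁻¹ = ENNReal.ofReal ((1 - (2 : ℝ) ^ s)⁻¹) := by
    rw [hq, ← ENNReal.ofReal_one, ← ENNReal.ofReal_sub _ h2s,
      ENNReal.ofReal_inv_of_pos (by linarith)]
  calc ∑' k : ℕ, ENNReal.ofReal (B * (2 ^ k * R) ^ s)
      ≤ ∑' k : ℕ, ENNReal.ofReal (|B| * R ^ s) * q ^ k := ENNReal.tsum_le_tsum hterm
    _ = ENNReal.ofReal (|B| * R ^ s) * (1 - q)⁻¹ := by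
        rw [ENNReal.tsum_mul_left, ENNReal.tsum_geometric]
    _ = ENNReal.ofReal (|B| * (1 - (2 : ℝ) ^ s)⁻¹ * R ^ s) := by
        rw [hgeom, ← ENNReal.ofReal_mul (by positivity)]
        congr 1; ring

/-- **Corollary (polynomial tail of the high set).**  Under the hypotheses of
`volume_bernoulliHigh_inter_shell_le`: there are `C″` and `L₀ > 0` with
`|{y : h < ℋ(y)} ∩ {R ≤ |y|}| ≤ C″ R^{−1−2ρ}` for all `R ≥ L₀` — the quantity the volume-squeeze
heuristic (RESIDUE-MEMO-19832-g11 §2 (C2)) compares with `e^{−3γt}`; dyadic shells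
`2^k R ≤ |y| ≤ 2^{k+1} R` and the closed-form geometric tail. -/
theorem volume_bernoulliHigh_inter_far_le {ρ : ℝ} (hρ : 0 < ρ) (hρ1 : ρ < 1)
    {V : EuclideanSpace ℝ (Fin 3) → EuclideanSpace ℝ (Fin 3)} (hVm : AEStronglyMeasurable V volume)
    {c : ℝ≥0}
    (hA : ∀ L : ℝ, 0 < L → ∫⁻ y in ball (0 : EuclideanSpace ℝ (Fin 3)) L, ‖V y‖ₑ ^ 2 ≤
      c * ENNReal.ofReal (L ^ (1 - 2 * ρ)))
    {P : EuclideanSpace ℝ (Fin 3) → ℝ} (hPm : AEStronglyMeasurable P volume) {C : ℝ}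
    (hD : ∫⁻ y, ‖P y‖ₑ ^ (3 / 2 : ℝ) * ENNReal.ofReal (‖y‖ ^ (2 * ρ - 2)) ≤ ENNReal.ofReal C)
    (h : ℝ) :
    ∃ C'' L₀ : ℝ, 0 < L₀ ∧ ∀ R : ℝ, L₀ ≤ R →
      volume ({y : EuclideanSpace ℝ (Fin 3) | h < selfSimilarBernoulli (1 / (2 + ρ)) 0 V P y} ∩
        {y | R ≤ ‖y‖}) ≤ ENNReal.ofReal (C'' * R ^ (-1 - 2 * ρ)) := by
  obtain ⟨C', L₀, hL₀, hshell⟩ := volume_bernoulliHigh_inter_shell_le hρ hρ1 hVm hA hPm hD h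
  refine ⟨|C'| * (1 - (2 : ℝ) ^ (-1 - 2 * ρ))⁻¹, L₀, hL₀, fun R hR => ?_⟩
  have hRpos : 0 < R := lt_of_lt_of_le hL₀ hR
  set Θ : Set (EuclideanSpace ℝ (Fin 3)) :=
    {y | h < selfSimilarBernoulli (1 / (2 + ρ)) 0 V P y} with hΘ
  set Sh : ℕ → Set (EuclideanSpace ℝ (Fin 3)) :=
    fun k => Θ ∩ {y | 2 ^ k * R ≤ ‖y‖ ∧ ‖y‖ ≤ 2 * (2 ^ k * R)} with hSh
  have hcover : Θ ∩ {y | R ≤ ‖y‖} ⊆ ⋃ k : ℕ, Sh k := by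
    rintro y ⟨hy, hyR⟩
    have h1 : 1 ≤ ‖y‖ / R := by rw [le_div_iff₀ hRpos]; simpa using hyR
    obtain ⟨k, hk1, hk2⟩ := exists_nat_pow_near h1 one_lt_two
    refine mem_iUnion.mpr ⟨k, hy, ?_, ?_⟩
    · have := (le_div_iff₀ hRpos).mp hk1
      linarith
    · have := (div_lt_iff₀ hRpos).mp hk2
      rw [pow_succ] at this
      linarith
  have hSk : ∀ k : ℕ, volume (Sh k) ≤ ENNReal.ofReal (C' * (2 ^ k * R) ^ (-1 - 2 * ρ)) := fun k =>
    hshell _ (hR.trans (le_mul_of_one_le_left hRpos.le (one_le_pow₀ one_le_two)))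
  calc volume (Θ ∩ {y | R ≤ ‖y‖}) ≤ volume (⋃ k : ℕ, Sh k) := measure_mono hcover
    _ ≤ ∑' k : ℕ, volume (Sh k) := measure_iUnion_le _
    _ ≤ ∑' k : ℕ, ENNReal.ofReal (C' * (2 ^ k * R) ^ (-1 - 2 * ρ)) := ENNReal.tsum_le_tsum hSk
    _ ≤ ENNReal.ofReal (|C'| * (1 - (2 : ℝ) ^ (-1 - 2 * ρ))⁻¹ * R ^ (-1 - 2 * ρ)) :=
        tsum_ofReal_mul_two_pow_mul_rpow_le C' hRpos (by linarith)

end Summit.NavierStokesRegularity.NavierStokesRegularity.Theorems.PowerGaugeEulerLiouville.BernoulliThinness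

end
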